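import Summits.QuantumFields.BalabanUV.T4Continuum.Support.CovariantLineTransportersRegular
import Summits.QuantumFields.BalabanUV.T4Continuum.Spine.NE2BalabanLayerSharp

/-!
# T⁴ programme, spine node NE2 (U1a) — THE LINE PRESENTATION AS A B3-SLOT FILLER OF THE TIER-B ASSEMBLY (variant (γ), NOT the
# instance of record): geometric packaging of row B3.a-vec's Gram law, its per-bond and level-background forms, and the insertion
# BY NAME into leaf-08's / leaf-03's `perturbationLaws_tierB_sharp` (support row B3.a-vec-bond, file 3)

NE2 formalisation swarm, seat `b2b-balaban-t4-ne2-formalise-leaf-02` (GEN 2).  The tier-B assembly (`Spine/NE2BalabanLayer`, leaf-08;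
`Spine/NE2BalabanLayerSharp`, leaf-03) takes its B3 slot as ANY family `P₃` with `PerturbationLaws (Δ_a ⊗ 1) P₃ (J ⊗ 1) κ₃ (C₃·L^{−k})`
(GEOMETRIC consistency).  The line presentation's Gram law (`CovariantLineAveragingTower.perturbationLaws_covariantLineGram`, rows
B3.a-vec / B3.a-vec-bond) concludes with the composite error `‖c‖·e2gram … (deltaComp …) k`; the geometric packaging was so far done INSIDE
`towerLimitRate_covariantLineGram`.  This file exports it and plugs it in:
 * §1 **`perturbationLaws_covariantLineGram_geom`**: `LineTransportLaws T Rl αT αR βs` + geometric budget `Σ_{j<k} 2βs k j ≤ Ccs·L^{−k}` ⟹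
   `PerturbationLaws (Δ_a ⊗ 1) (gramPert c Bref (Eline T Rl)) (J ⊗ 1) (kappaLine d L a αT αR c) (k ↦ C2line d L a αT αR Ccs c·L^{−k})`;
   the per-bond form **`…_of_bonds_geom`** (`BondTowerLaws U αb βb`) and the level-background form **`…_of_regular_levels_geom`**
   (`RegularTransporters R α β` + unitarity, `Ccs = 0`, NO `hNE3`);
 * §2 **`perturbationLaws_tierB_sharp_line`** = `NE2BalabanLayerSharp.perturbationLaws_tierB_sharp` with `hP₃ :=` §1's level-background law
   for the SAME tower `R` that fills the B2 slot, and **`tierB_rate_at_one_sharp_line`** (`t = 1` under the DISPLAYED threshold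
   `kappaBs o d a α β (kappaLine d L a (ℓαL⁻¹) α a) κ₄ < 1`).  BINDERS of the (γ) root: `hreg` (row B5), `hR1` (unitarity), `hNE3` (node NE3 —
   consumed by the B2 SLOT ONLY), `hP₄` (row B4 slot).  The B3 slot contributes NO NE3 dependence in this variant.
WHAT THIS IS AND IS NOT.  A typed input for the typer's question A-typer-3 / the carver's c1: the (γ) = line-presentation-with-LEVEL-backgrounds
variant of ROOT B, every binder displayed.  It is NOT the (α) instance of record (REFEREE c8: leaf-07's `QcovLev` + leaf-06/03's nested-contour
two-level law + leaf-01's `…_balaban_of_bond`), NOT Bałaban's `Q_k(U_k(V))` (whose one-step backgrounds are the depth-dependent averages —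
the `βb` budget of `BondTowerLaws`, cf. `CovariantLineTransporters` §6), and asserts NO identification between the presentations (c5).

HONEST FRAMING (T4-DAG p. 1).  Re-packaging and re-assembly BY NAME at MODEL LEVEL (transporters DATA, global small field, regular gauge and
unitarity as hypothesis shapes); ROOT B (any variant) stays CONDITIONAL on node NE3's `LocalRate` (displayed), on the regularity class and on the
B4 slot; NOT [B9] (3.15)/(3.23)–(3.26) as printed; **NE2 NOT PROVED**; NOT infinite volume / mass gap / Clay / summit progress; spine 0/9
unchanged.  HONEST DEPENDENCY: continuum YM on T⁴ ⇐ BetaPertH ∧ nine spine estimates (0/9 proved); BetaPertH ⇐ (D1) ∧ (D4) ∧ CAP+tail; G-an2-4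
gates asym, D1 and NE2/3/4.  ABSOLUTE RULE kept; no `sorry`.
-/

noncomputable section

open scoped BigOperators ComplexConjugate Matrix Matrix.Norms.L2Operator Kronecker

namespace Summit.QuantumFields.BalabanUV.T4Continuum.CovariantLineSlot

open Literature.MathematicalPhysics.QuantumFieldTheory.Balaban1983to89.B5Prop11Plancherel (fine Tor Cst Cst_nonneg)
open Literature.MathematicalPhysics.QuantumFieldTheory.Balaban1983to89.B5G183RateUnitTower (lev lev_neZero)
open Literature.MathematicalPhysics.QuantumFieldTheory.Balaban1983to89.T4EtaRateMin (LocalRate)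
open Summit.QuantumFields.BalabanUV.T4Continuum
open Summit.QuantumFields.BalabanUV.T4Continuum.BalabanAveragedTowerUnit (idx Qlev)
open Summit.QuantumFields.BalabanUV.T4Continuum.BackgroundResolventTower
open Summit.QuantumFields.BalabanUV.T4Continuum.KingPairingPlantedLaw
open Summit.QuantumFields.BalabanUV.T4Continuum.CovariantAveragingTower (TowerLimitRate)
open Summit.QuantumFields.BalabanUV.T4Continuum.KroneckerLift
open Summit.QuantumFields.BalabanUV.T4Continuum.PerturbationAlgebra (perturbationLaws_mono)
open Summit.QuantumFields.BalabanUV.T4Continuum.GramPerturbationLaw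
open Summit.QuantumFields.BalabanUV.T4Continuum.CompositeAveragingLaw
open Summit.QuantumFields.BalabanUV.T4Continuum.CovariantLineAveragingTower
open Summit.QuantumFields.BalabanUV.T4Continuum.CovariantLineTransporters
open Summit.QuantumFields.BalabanUV.T4Continuum.CovariantLineTransportersRegular
open Summit.QuantumFields.BalabanUV.T4Continuum.NE2FromNE3 (bgReadings)
open Summit.QuantumFields.BalabanUV.T4Continuum.RegularBackgroundTower (RegularTransporters regClass)
open Summit.QuantumFields.BalabanUV.T4Continuum.NE2BalabanLayer (tierBPert)
open Summit.QuantumFields.BalabanUV.T4Continuum.NE2BalabanLayerSharp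

variable {d : ℕ} (L : ℕ) [NeZero L] (M : Fin d → ℕ) [hM : ∀ μ, NeZero (M μ)] (a : ℝ) (ha : 0 < a) {o : Type*} [Fintype o] [DecidableEq o]

/-! ## §1 Geometric packaging of the line presentation's Gram law -/

section Geom

variable {T : ℕ → (j : ℕ) → idx L M (j + 1) → Matrix o o ℂ} {Rl : ℕ → (j : ℕ) → Fin L → idx L M (j + 1) → Matrix o o ℂ}
  {αT αR : ℝ} {βs : ℕ → ℕ → ℝ}

/-- **THE GRAM ROW OF THE LINE PRESENTATION WITH GEOMETRIC CONSISTENCY** (`L ≥ 2`, budget `Σ_{j<k} 2βs k j ≤ Ccs·L^{−k}`):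
`PerturbationLaws (Δ_a ⊗ 1) (c·((Q^U)ᴴQ^U − QᴴQ)) (J ⊗ 1) (kappaLine d L a αT αR c) (k ↦ C2line d L a αT αR Ccs c·L^{−k})` — the shape the
tier-B assembly's B3 slot takes. [folklore] -/
theorem perturbationLaws_covariantLineGram_geom (hL : 2 ≤ L) (h : LineTransportLaws L M T Rl αT αR βs) {Ccs : ℝ}
    (hcs : ∀ k, ∑ j ∈ Finset.range k, 2 * βs k j ≤ Ccs * ((L : ℝ)⁻¹) ^ k) (c : ℂ) :
    PerturbationLaws (fun k => calDalev L M a ha k ⊗ₖ (1 : Matrix o o ℂ)) (gramPert c (Bref L M) (Eline L M T Rl))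
      (fun k => JpcT L M k ⊗ₖ (1 : Matrix o o ℂ)) (kappaLine d L a αT αR c) (fun k => C2line d L a αT αR Ccs c * ((L : ℝ)⁻¹) ^ k) := by
  have hL1 : (1 : ℝ) < L := by exact_mod_cast (lt_of_lt_of_le one_lt_two hL : 1 < L)
  have hα : 0 ≤ αT + αR := add_nonneg h.nonneg.1 h.nonneg.2.1
  have hε : 0 ≤ epsComp (αT + αR) ((L : ℝ)⁻¹) := by
    unfold epsComp
    exact mul_nonneg (bexp_pos _ _).le (mul_nonneg hα (inv_nonneg.mpr (sub_nonneg.mpr (inv_lt_one_of_one_lt₀ hL1).le)))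
  refine perturbationLaws_mono (perturbationLaws_covariantLineGram L M a ha hL h c) le_rfl fun k => ?_
  refine (mul_le_mul_of_nonneg_left (e2gram_le_geom (ρ := (L : ℝ)⁻¹) (Cst_nonneg d a) zero_le_one hε (fun k => le_rfl)
    (fun k => le_rfl) (fun k => le_rfl) (deltaComp_le_geom L a hL hα h.nonneg.2.2 hcs) k) (norm_nonneg c)).trans (le_of_eq ?_)
  unfold C2line; ring

end Geom

section Bonds

variable {Γ : StepContours L M} {ℓ : ℕ} {U : ℕ → (j : ℕ) → idx L M (j + 1) → Matrix o o ℂ} {αb : ℝ} {βb : ℕ → ℕ → ℝ}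

/-- the per-bond form: `BondTowerLaws U αb βb` + geometric per-bond budget `Σ_{j<k} 2(ℓ + L)βb k j ≤ Ccs·L^{−k}`. [folklore] -/
theorem perturbationLaws_covariantLineGram_of_bonds_geom (hL : 2 ≤ L) (hΓ : ∀ j x, (Γ j x).length ≤ ℓ) (h : BondTowerLaws L M U αb βb)
    {Ccs : ℝ} (hcs : ∀ k, ∑ j ∈ Finset.range k, 2 * ((ℓ + L) * βb k j) ≤ Ccs * ((L : ℝ)⁻¹) ^ k) (c : ℂ) :
    PerturbationLaws (fun k => calDalev L M a ha k ⊗ₖ (1 : Matrix o o ℂ)) (gramPert c (Bref L M) (Eline L M (Tb L M Γ U) (Rlb L M U)))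
      (fun k => JpcT L M k ⊗ₖ (1 : Matrix o o ℂ)) (kappaLine d L a (ℓ * αb * (L : ℝ)⁻¹) αb c)
      (fun k => C2line d L a (ℓ * αb * (L : ℝ)⁻¹) αb Ccs c * ((L : ℝ)⁻¹) ^ k) :=
  perturbationLaws_covariantLineGram_geom L M a ha hL (lineTransportLaws_of_bonds L M hΓ h) hcs c

/-- **the level-background form, from the regularity class and unitarity ALONE** (`Ccs = 0`, NO `hNE3`). [folklore] -/
theorem perturbationLaws_covariantLineGram_of_regular_levels_geom (hL : 2 ≤ L) (hΓ : ∀ j x, (Γ j x).length ≤ ℓ)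
    {R : (k : ℕ) → Fin d → (idx L M k → Matrix o o ℂ)} {α β : ℝ} (hreg : RegularTransporters L M R α β)
    (hR1 : ∀ k ν (i : idx L M k), ‖R k ν i‖ ≤ 1) (c : ℂ) :
    PerturbationLaws (fun k => calDalev L M a ha k ⊗ₖ (1 : Matrix o o ℂ))
      (gramPert c (Bref L M) (Eline L M (Tb L M Γ (fun _ j => levelBonds L M R (j + 1))) (Rlb L M (fun _ j => levelBonds L M R (j + 1)))))
      (fun k => JpcT L M k ⊗ₖ (1 : Matrix o o ℂ)) (kappaLine d L a (ℓ * α * (L : ℝ)⁻¹) α c)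
      (fun k => C2line d L a (ℓ * α * (L : ℝ)⁻¹) α 0 c * ((L : ℝ)⁻¹) ^ k) :=
  perturbationLaws_covariantLineGram_of_bonds_geom L M a ha hL hΓ (bondTowerLaws_of_regular L M hreg hR1) (fun k => by simp) c

end Bonds

/-! ## §2 The insertion into the tier-B assembly (variant (γ): B3 slot = line presentation with level backgrounds) -/

section Assembly

variable {Γ : StepContours L M} {ℓ : ℕ}

/-- the line presentation's B3-slot family at the physical coupling `c = a`: `P₃^{line} = a·((Q^U)ᴴQ^U − QᴴQ)` for the level backgrounds of
the tower `R`. [folklore] -/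
def lineSlot (Γ : StepContours L M) (R : (k : ℕ) → Fin d → (idx L M k → Matrix o o ℂ)) :
    (k : ℕ) → Matrix (idx L M k × o) (idx L M k × o) ℂ :=
  gramPert (a : ℂ) (Bref L M) (Eline L M (Tb L M Γ (fun _ j => levelBonds L M R (j + 1))) (Rlb L M (fun _ j => levelBonds L M R (j + 1))))

/-- **`PerturbationLaws` FOR THE TIER-B ASSEMBLY WITH THE LINE PRESENTATION IN THE B3 SLOT, SHARP `κ`** (`L ≥ 2`, `d ≥ 1`) =
`NE2BalabanLayerSharp.perturbationLaws_tierB_sharp` with `hP₃ := perturbationLaws_covariantLineGram_of_regular_levels_geom` for the SAME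
tower `R` that fills the B2 slot.  Binders displayed: `hreg`, `hR1`, `hNE3` (B2 slot only), `hP₄`.  Variant (γ), NOT the instance of record.
[folklore] -/
theorem perturbationLaws_tierB_sharp_line (hL : 2 ≤ L) (hd : 1 ≤ d) (hΓ : ∀ j x, (Γ j x).length ≤ ℓ)
    {R : (k : ℕ) → Fin d → (idx L M k → Matrix o o ℂ)} {α β : ℝ} (hreg : RegularTransporters L M R α β)
    (hR1 : ∀ k ν (i : idx L M k), ‖R k ν i‖ ≤ 1) {C : ℝ} (hC : 0 ≤ C) (hNE3 : LocalRate (bgReadings L M (regClass L M R)) C ((L : ℝ)⁻¹))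
    {P₄ : (k : ℕ) → Matrix (idx L M k × o) (idx L M k × o) ℂ} {κ₄ C₄ : ℝ}
    (hP₄ : PerturbationLaws (fun k => calDalev L M a ha k ⊗ₖ (1 : Matrix o o ℂ)) P₄ (fun k => JpcT L M k ⊗ₖ (1 : Matrix o o ℂ)) κ₄
      (fun k => C₄ * ((L : ℝ)⁻¹) ^ k)) :
    PerturbationLaws (fun k => calDalev L M a ha k ⊗ₖ (1 : Matrix o o ℂ)) (tierBPert L M R (lineSlot L M a Γ R) P₄)
      (fun k => JpcT L M k ⊗ₖ (1 : Matrix o o ℂ)) (kappaBs o d a α β (kappaLine d L a (ℓ * α * (L : ℝ)⁻¹) α (a : ℂ)) κ₄)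
      (fun k => C2Bs o d L a α β C (C2line d L a (ℓ * α * (L : ℝ)⁻¹) α 0 (a : ℂ)) C₄ * ((L : ℝ)⁻¹) ^ k) :=
  perturbationLaws_tierB_sharp L M a ha hd hreg hC hNE3
    (perturbationLaws_covariantLineGram_of_regular_levels_geom L M a ha hL hΓ hreg hR1 (a : ℂ)) hP₄

/-- **THE `t = 1` RATE OF THE TIER-B OPERATOR WITH THE LINE PRESENTATION IN THE B3 SLOT** (`L ≥ 2`, `d ≥ 1`) under the DISPLAYED threshold
`kappaBs o d a α β (kappaLine d L a (ℓαL⁻¹) α a) κ₄ < 1`: the lifted King-averaged unit-lattice covariances of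
`(Δ_a^{(k)} ⊗ 1 + covPertC R k + P₃^{line} k + P₄ k)⁻¹` converge with rate `L^{−k}` — CONDITIONAL on `hNE3` (B2 slot; ANY `C ≥ 0`), `hreg`,
`hR1`, `hP₄`, displayed.  Variant (γ); NE2 is NOT proved by this. [folklore] -/
theorem tierB_rate_at_one_sharp_line (hL : 2 ≤ L) (hd : 1 ≤ d) (hΓ : ∀ j x, (Γ j x).length ≤ ℓ)
    {R : (k : ℕ) → Fin d → (idx L M k → Matrix o o ℂ)} {α β : ℝ} (hreg : RegularTransporters L M R α β)
    (hR1 : ∀ k ν (i : idx L M k), ‖R k ν i‖ ≤ 1) {C : ℝ} (hC : 0 ≤ C) (hNE3 : LocalRate (bgReadings L M (regClass L M R)) C ((L : ℝ)⁻¹))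
    {P₄ : (k : ℕ) → Matrix (idx L M k × o) (idx L M k × o) ℂ} {κ₄ C₄ : ℝ}
    (hP₄ : PerturbationLaws (fun k => calDalev L M a ha k ⊗ₖ (1 : Matrix o o ℂ)) P₄ (fun k => JpcT L M k ⊗ₖ (1 : Matrix o o ℂ)) κ₄
      (fun k => C₄ * ((L : ℝ)⁻¹) ^ k)) (hsmall : kappaBs o d a α β (kappaLine d L a (ℓ * α * (L : ℝ)⁻¹) α (a : ℂ)) κ₄ < 1) :
    TowerLimitRate (fun k => Qlev L M k ⊗ₖ (1 : Matrix o o ℂ)) ((L : ℝ) ^ d)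
      (fun k => (calDalev L M a ha k ⊗ₖ (1 : Matrix o o ℂ) + tierBPert L M R (lineSlot L M a Γ R) P₄ k)⁻¹)
      (Cpert (kappaBs o d a α β (kappaLine d L a (ℓ * α * (L : ℝ)⁻¹) α (a : ℂ)) κ₄) (2 * d * Cst d a) (CJ d a)
        (C2Bs o d L a α β C (C2line d L a (ℓ * α * (L : ℝ)⁻¹) α 0 (a : ℂ)) C₄) 0 1) ((L : ℝ)⁻¹) :=
  tierB_rate_at_one_sharp L M a ha hL hd hreg hC hNE3
    (perturbationLaws_covariantLineGram_of_regular_levels_geom L M a ha hL hΓ hreg hR1 (a : ℂ)) hP₄ hsmall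

/-- at `R = 1` the line slot vanishes identically (c5: the typed operator is Bałaban's `Q_k ⊗ 1` at `U = 1`). [folklore] -/
theorem lineSlot_one (Γ : StepContours L M) (k : ℕ) :
    lineSlot L M a Γ (fun _ _ _ => (1 : Matrix o o ℂ)) k = 0 := by
  have hT : Tb L M Γ (fun _ j => levelBonds L M (fun _ _ _ => (1 : Matrix o o ℂ)) (j + 1)) = fun _ _ _ => 1 := by
    funext k j x; exact prod_map_one _
  have hR : Rlb L M (fun _ j => levelBonds L M (fun _ _ _ => (1 : Matrix o o ℂ)) (j + 1)) = fun _ _ _ _ => 1 := by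
    funext k j t x; exact prod_map_one _
  rw [lineSlot, hT, hR, gramPert, gramCore]
  have hE : Eline L M (fun _ _ _ => (1 : Matrix o o ℂ)) (fun _ _ _ _ => (1 : Matrix o o ℂ)) k = 0 := by
    rw [Eline_eq, QcovLine_one_one, sub_self]
  rw [hE, add_zero, sub_self, smul_zero]

end Assembly

end Summit.QuantumFields.BalabanUV.T4Continuum.CovariantLineSlot

end
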